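import Mathlib.Analysis.SpecialFunctions.Log.Basic
import Mathlib.Analysis.SpecialFunctions.Pow.Real
import Mathlib.Analysis.SpecialFunctions.Sqrt
import Mathlib.Topology.Algebra.InfiniteSum.Real
import Mathlib.Topology.Algebra.Order.LiminfLimsup
import Literature.Barriers.CriticalPhenomena.WeaklySAWCouplingFlow
import HarnessLib

/-!
# The perturbed flow of the coupling constant, `ǧ_{j+1} = ǧ_j - β_jǧ_j² + r_j`:
# `ǧ_∞⁻¹ + O(|log ǧ_∞|) = g₀⁻¹ + Σ_jβ_j` and `ǧ_∞ ∼ 1/Σ_jβ_j`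
# (Bauerschmidt–Brydges–Slade 2015, §8.3, the second lemma, WITH its remainder term)

Support file (theorems only) for the renormalisation-group half of
`Literature.Barriers.CriticalPhenomena.WeaklySAWFourDimLogCorrections` (= BBS 2015, Theorem 1.1,
`CTWSAW.BBS2015_thm11`), which the tree reduces to Theorem 4.1 alone (`CTWSAW.BBS2015_thm41.thm11`,
`WeaklySAWFourDimLogCorrectionsCesaroAssembly.lean`). Continuation of `WeaklySAWCouplingFlow.lean`,
which treats the UNPERTURBED recursion `ḡ_{j+1} = ḡ_j - β_jḡ_j²` (`r_j = 0`).

In the proof of Theorem 4.1 (§8.3–§8.4 of R. Bauerschmidt, D. C. Brydges, G. Slade, CMP 337 (2015),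
arXiv:1403.7422) the coupling constant of the full renormalisation-group flow obeys the PERTURBED
recursion (the display before the second lemma of §8.3)

  `ǧ_{j+1} = ǧ_j - β_jǧ_j² + r_j` with `r_j = O(χ_jǧ_j³) = O(ḡ_j³)`,

the remainder `r_j` coming from the non-perturbative coordinate (the estimates of the
renormalisation-group step, §6.4, along the global flow of §7.1–§7.2), and the second lemma of §8.3
("for `(m²,g₀) ∈ (0,δ)²` the limit `ǧ_∞ = lim_j ǧ_j` exists … and `ǧ_∞ ∼ 1/𝖡_{m²}` as `m² ↓ 0`,
`g₀ → ĝ₀`") is proved from it in two displayed steps: "`ǧ_k⁻¹ = g₀⁻¹ + Σ_{j<k}β_j + O(log ǧ_k)`"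
(by the summation formula with `ψ(t) = t⁻²`, "proved in [BBS-rg-flow] for the special case
`r_j = 0`, but the same proof applies when `r_j = O(χ_jǧ_j³)`", the remainder contributing
`Σ_{l<k} r_lǧ_l⁻² = O(Σ_{l<k}χ_lḡ_l) = O(log ǧ_k)`), and therefore, by the first lemma of §8.3
(`Σ_jβ_j = 𝖡_{m²}`), "`ǧ_∞⁻¹ + O(|log ǧ_∞|) = g₀⁻¹ + 𝖡_{m²}`", whence `ǧ_∞ ∼ 1/𝖡_{m²}`.

This file proves exactly this mechanism for an ARBITRARY real sequence `ǧ = g` obeying the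
perturbed recursion, with explicit constants in place of the printed `O(·)`. The inputs that the
source takes from elsewhere appear as hypotheses (`GchHyp`): `0 ≤ β_j ≤ B` (§6.1: `β_j > 0`;
Assumption (A1): `sup_j|β_j| < ∞`); the a-priori bound `ǧ_j ≤ 2g₀` (in the source from the
flow theorem of §7.2, `|ǧ_j - ḡ_j| ≤ O(ḡ_j²|log ḡ_j|)`, and `ḡ_j ≤ g₀`); and the remainder bound in
the form
`|r_j| ≤ ρ_jǧ_j²` with `0 ≤ ρ_j ≤ 1/4` — in the source `ρ_j = Rχ_jǧ_j`, so that `Σ_{l<k}ρ_l` is the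
quantity bounded there by `O(|log ǧ_k|)` through [BBS-rg-flow, Lemma 2.1(ii)(a)]; here `Σ_{l<k}ρ_l`
is carried along explicitly and the `O(|log ǧ_∞|)` shape enters only as the hypothesis of the final
asymptotic statement. Proved:

* positivity `ǧ_j > 0` and `ǧ_{j+1} ≥ ǧ_j/2` (`GchHyp.g_pos`, `GchHyp.g_succ_ge`);
* one step (`GchHyp.inv_succ_sub_inv_sub_beta`, `GchHyp.abs_inv_succ_sub_le`):
  `ǧ_{j+1}⁻¹ - ǧ_j⁻¹ - β_j = [β_jǧ_j(β_jǧ_j² - r_j) - r_j]/(ǧ_jǧ_{j+1})`, of absolute value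
  `≤ 2Bβ_jǧ_j + (5/2)ρ_j`; and `β_jǧ_j ≤ log(ǧ_j/ǧ_{j+1}) + ρ_jǧ_j` (`GchHyp.beta_mul_le_log_add`);
* the display with remainder (`GchHyp.abs_inv_sub_le`):
  `|ǧ_k⁻¹ - g₀⁻¹ - Σ_{j<k}β_j| ≤ 2B log(g₀/ǧ_k) + 3Σ_{j<k}ρ_j` for every `k`
  (for `r = 0` compare `inv_gbar_ge`/`inv_gbar_le` of `WeaklySAWCouplingFlow.lean`);
* for summable `ρ` (the massive case `m² > 0` of the source, where `Σ_jχ_j < ∞`): the limit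
  `ǧ_∞ = lim_j ǧ_j` exists (`GchHyp.tendsto_limUnder`; via the non-increasing sequence
  `ǧ_j + Σ_{l≥j}|r_l|`), and if moreover `Σ_jβ_j < ∞` then `ǧ_∞ > 0` and
  `|ǧ_∞⁻¹ - g₀⁻¹ - Σ_jβ_j| ≤ 2B log(g₀/ǧ_∞) + 3Σ_jρ_j` (`GchHyp.limUnder_pos`,
  `GchHyp.abs_inv_limUnder_sub_le`) — "`ǧ_∞⁻¹ + O(|log ǧ_∞|) = g₀⁻¹ + 𝖡_{m²}`";
* the asymptotic step in the abstract (`tendsto_mul_of_abs_inv_sub_le`,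
  `tendsto_mul_of_abs_inv_sub_le_log`): if `0 < x_i ≤ 1`, `|x_i⁻¹ - g₀(i)⁻¹ - S_i| ≤ A + A'|log x_i|`
  eventually, `S_i → ∞` and `g₀(i) → ĝ₀ > 0`, then `x_iS_i → 1`; hence (`tendsto_limUnder_mul_tsum`)
  **`ǧ_∞ · Σ_jβ_j → 1`** along any family of perturbed flows with `Σ_jβ_j → ∞`, `g₀ → ĝ₀ > 0` and
  `Σ_jρ_j ≤ A + A'|log ǧ_∞|` — the source's "`ǧ_∞ ∼ 1/𝖡_{m²}`" given `Σ_jβ_j = 𝖡_{m²} → ∞`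
  (§8.3, first lemma, and (1.8), `BBS2015_eq18_holds`);
* consistency with the unperturbed file: `GbarHyp.gchHyp` (`ḡ` satisfies `GchHyp` with `ρ = 0`).

Not here: the bound `Σ_{l<k}χ_lǧ_l = O(|log ǧ_k|)` itself ([BBS-rg-flow, Lemma 2.1(ii)(a)] for the
perturbed flow), the continuity of `ǧ_∞` in `(m², g₀)`, and the existence of the flow (`r_j` is an
output of the renormalisation-group step, §6.4, §7.1, §8.1).

## References
* R. Bauerschmidt, D. C. Brydges, G. Slade, *Logarithmic correction for the susceptibility of the
  4-dimensional weakly self-avoiding walk: a renormalisation group analysis*, CMP 337 (2015),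
  §8.3 (the recursion for `ǧ` with remainder and the second lemma with its proof).
  [BauerschmidtBrydgesSlade2015LogCorr]
* R. Bauerschmidt, D. C. Brydges, G. Slade, *Structural stability of a dynamical system near a
  non-hyperbolic fixed point*, Ann. Henri Poincaré 16 (2015), Lemma 2.1 and its proof
  ((ii)(b): `ψ(t) = t⁻²`). [BauerschmidtBrydgesSlade2015Flow]
-/

noncomputable section

open Filter Topology Finset
open scoped BigOperators

namespace Literature.Barriers.CriticalPhenomena

namespace CTWSAW

/-! ### The perturbed recursion and the standing hypotheses -/

/-- The remainder `r_j = ǧ_{j+1} - (ǧ_j - β_jǧ_j²)` of a sequence `ǧ = g` relative to the quadratic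
recursion, so that `ǧ_{j+1} = ǧ_j - β_jǧ_j² + r_j` (`flowRem_spec`).
[cite: BauerschmidtBrydgesSlade2015LogCorr, §8.3 (the recursion ǧ_{j+1} = ǧ_j - β_jǧ_j² + r_j)] -/
def flowRem (β g : ℕ → ℝ) (j : ℕ) : ℝ :=
  g (j + 1) - (g j - β j * g j ^ 2)

/-- `ǧ_{j+1} = ǧ_j - β_jǧ_j² + r_j`. [cite: BauerschmidtBrydgesSlade2015LogCorr, §8.3 (the recursion for ǧ with remainder)] -/
theorem flowRem_spec (β g : ℕ → ℝ) (j : ℕ) :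
    g (j + 1) = g j - β j * g j ^ 2 + flowRem β g j := by
  unfold flowRem; ring

/-- The unperturbed flow `ḡ` has vanishing remainder. [cite: BauerschmidtBrydgesSlade2015Flow, §2.1 (the recursion for ḡ)] -/
@[simp] theorem flowRem_gbar (β : ℕ → ℝ) (g₀ : ℝ) (j : ℕ) : flowRem β (gbar β g₀) j = 0 := by
  simp [flowRem, gbar_succ]

/-- Standing hypotheses for the perturbed flow `ǧ = g` of the coupling constant (the inputs of the
proof of the second lemma of §8.3 of the source): the initial condition `ǧ₀ = g₀ ∈ (0, 1/2]`; the
a-priori bound `ǧ_j ≤ 2g₀` (in the source from the flow theorem of §7.2,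
`|ǧ_j - ḡ_j| ≤ O(ḡ_j²|log ḡ_j|)`, and `ḡ_j ≤ g₀`); `0 ≤ β_j ≤ B` (§6.1, Assumption (A1)) with the
smallness `Bg₀ ≤ 1/8`; and the remainder bound
`|r_j| ≤ ρ_jǧ_j²` with `0 ≤ ρ_j ≤ 1/4` (in the source `r_j = O(χ_jǧ_j³)`, i.e. `ρ_j = Rχ_jǧ_j`).
Positivity `ǧ_j > 0` is a consequence (`GchHyp.g_pos`).
[cite: BauerschmidtBrydgesSlade2015LogCorr, §8.3 (recursion for ǧ, r_j = O(χ_jǧ_j³)); §7.2 (theorem, (i): |ǧ_j - ḡ_j| ≤ O(ḡ_j²|log ḡ_j|))]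
[cite: BauerschmidtBrydgesSlade2015Flow, Assumption (A1)] -/
structure GchHyp (β ρ g : ℕ → ℝ) (B g₀ : ℝ) : Prop where
  /-- `ǧ₀ = g₀`. -/
  init : g 0 = g₀
  /-- `g₀ > 0`. -/
  pos₀ : 0 < g₀
  /-- `g₀ ≤ 1/2` (so that `ǧ_j ≤ 1`). -/
  g₀_le : g₀ ≤ 1 / 2
  /-- a-priori bound `ǧ_j ≤ 2g₀`. -/
  le_two_mul : ∀ j, g j ≤ 2 * g₀
  /-- `β_j ≥ 0`. -/
  beta_nonneg : ∀ j, 0 ≤ β j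
  /-- `β_j ≤ B`. -/
  beta_le : ∀ j, β j ≤ B
  /-- smallness of `g₀` relative to `B = sup β`. -/
  small : B * g₀ ≤ 1 / 8
  /-- `ρ_j ≥ 0`. -/
  rho_nonneg : ∀ j, 0 ≤ ρ j
  /-- `ρ_j ≤ 1/4`. -/
  rho_le : ∀ j, ρ j ≤ 1 / 4
  /-- the remainder bound `|r_j| ≤ ρ_jǧ_j²`. -/
  rem_le : ∀ j, |flowRem β g j| ≤ ρ j * g j ^ 2

/-- The unperturbed flow `ḡ` of `WeaklySAWCouplingFlow.lean` satisfies the standing hypotheses with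
`ρ = 0` (given the slightly stronger smallness used here).
[cite: BauerschmidtBrydgesSlade2015Flow, Lemma 2.1(i) (0 < ḡ_j ≤ g₀)] -/
theorem GbarHyp.gchHyp {β : ℕ → ℝ} {B g₀ : ℝ} (h : GbarHyp β B g₀) (hsmall : B * g₀ ≤ 1 / 8)
    (hg₀ : g₀ ≤ 1 / 2) : GchHyp β 0 (gbar β g₀) B g₀ where
  init := gbar_zero β g₀
  pos₀ := h.pos
  g₀_le := hg₀
  le_two_mul j := (h.gbar_le_init j).trans (by linarith [h.pos])
  beta_nonneg := h.beta_nonneg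
  beta_le := h.beta_le
  small := hsmall
  rho_nonneg _ := by simp
  rho_le _ := by simp
  rem_le j := by simp

namespace GchHyp

variable {β ρ g : ℕ → ℝ} {B g₀ : ℝ} (h : GchHyp β ρ g B g₀)
include h

/-! ### Positivity, one-step comparison -/

/-- `B ≥ 0`. [folklore] -/
theorem B_nonneg : 0 ≤ B := (h.beta_nonneg 0).trans (h.beta_le 0)

/-- `ǧ_j ≤ 1`. [folklore] -/
theorem g_le_one (j : ℕ) : g j ≤ 1 := (h.le_two_mul j).trans (by linarith [h.g₀_le])

/-- `β_jǧ_j ≤ 1/4` (when `ǧ_j ≥ 0`). [cite: BauerschmidtBrydgesSlade2015Flow, Lemma 2.1 (proof of (i): β_jḡ_j small)] -/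
theorem beta_mul_le_quarter {j : ℕ} (hg : 0 ≤ g j) : β j * g j ≤ 1 / 4 :=
  calc β j * g j ≤ B * (2 * g₀) := mul_le_mul (h.beta_le j) (h.le_two_mul j) hg h.B_nonneg
    _ ≤ 1 / 4 := by linarith [h.small]

/-- The inductive step `ǧ_j > 0 ⇒ ǧ_{j+1} ≥ ǧ_j/2` (`β_jǧ_j² ≤ ǧ_j/4`, `|r_j| ≤ ǧ_j²/4 ≤ ǧ_j/4`).
[cite: BauerschmidtBrydgesSlade2015Flow, Lemma 2.1(i) (ḡ_jḡ_{j+1}⁻¹ = 1 + O(ḡ₀))] -/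
theorem succ_ge_half_of_pos {j : ℕ} (hpos : 0 < g j) : g j / 2 ≤ g (j + 1) := by
  have h1 : β j * g j ^ 2 ≤ 1 / 4 * g j := by
    nlinarith [h.beta_mul_le_quarter hpos.le, hpos]
  have h2 : |flowRem β g j| ≤ 1 / 4 * g j :=
    calc |flowRem β g j| ≤ ρ j * g j ^ 2 := h.rem_le j
      _ ≤ 1 / 4 * g j ^ 2 := mul_le_mul_of_nonneg_right (h.rho_le j) (sq_nonneg _)
      _ ≤ 1 / 4 * g j := by nlinarith [h.g_le_one j, hpos]
  have h3 := neg_abs_le (flowRem β g j)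
  rw [flowRem_spec β g j]
  linarith

/-- **`ǧ_j > 0`** for all `j`. [cite: BauerschmidtBrydgesSlade2015Flow, Lemma 2.1(i) (ḡ_j > 0)] -/
theorem g_pos (j : ℕ) : 0 < g j := by
  induction j with
  | zero => rw [h.init]; exact h.pos₀
  | succ j ih => linarith [h.succ_ge_half_of_pos ih]

/-- `ǧ_{j+1} ≥ ǧ_j/2`. [cite: BauerschmidtBrydgesSlade2015Flow, Lemma 2.1(i) (ḡ_jḡ_{j+1}⁻¹ = 1 + O(ḡ₀))] -/
theorem g_succ_ge (j : ℕ) : g j / 2 ≤ g (j + 1) := h.succ_ge_half_of_pos (h.g_pos j)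

/-- `β_jǧ_j ∈ [0, 1/4]`. [cite: BauerschmidtBrydgesSlade2015Flow, Lemma 2.1 (proof of (i))] -/
theorem beta_mul_mem (j : ℕ) : β j * g j ∈ Set.Icc (0 : ℝ) (1 / 4) :=
  ⟨mul_nonneg (h.beta_nonneg j) (h.g_pos j).le, h.beta_mul_le_quarter (h.g_pos j).le⟩

/-- `|r_j| ≤ ρ_jǧ_j² ≤ (1/4)ǧ_j²`. [cite: BauerschmidtBrydgesSlade2015LogCorr, §8.3 (r_j = O(χ_jǧ_j³))] -/
theorem abs_rem_le (j : ℕ) : |flowRem β g j| ≤ 1 / 4 * g j ^ 2 :=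
  (h.rem_le j).trans (mul_le_mul_of_nonneg_right (h.rho_le j) (sq_nonneg _))

/-- `ǧ_{j+1} ≤ ǧ_j + |r_j|`. [cite: BauerschmidtBrydgesSlade2015LogCorr, §8.3 (the recursion for ǧ)] -/
theorem g_succ_le (j : ℕ) : g (j + 1) ≤ g j + |flowRem β g j| := by
  have h1 : 0 ≤ β j * g j ^ 2 := mul_nonneg (h.beta_nonneg j) (sq_nonneg _)
  have h2 := le_abs_self (flowRem β g j)
  rw [flowRem_spec β g j]
  linarith

/-! ### One step of the reciprocal: `ǧ_{j+1}⁻¹ - ǧ_j⁻¹ - β_j` -/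

/-- The one-step identity
`ǧ_{j+1}⁻¹ - ǧ_j⁻¹ - β_j = [β_jǧ_j(β_jǧ_j² - r_j) - r_j]/(ǧ_jǧ_{j+1})`.
[cite: BauerschmidtBrydgesSlade2015Flow, Lemma 2.1 (proof of (ii)(b), ψ(t) = t⁻²)] -/
theorem inv_succ_sub_inv_sub_beta (j : ℕ) :
    (g (j + 1))⁻¹ - (g j)⁻¹ - β j =
      (β j * g j * (β j * g j ^ 2 - flowRem β g j) - flowRem β g j) / (g j * g (j + 1)) := by
  have hj := (h.g_pos j).ne'
  have hj1 := (h.g_pos (j + 1)).ne'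
  have e := flowRem_spec β g j
  rw [eq_div_iff (mul_ne_zero hj hj1)]
  have e2 : ((g (j + 1))⁻¹ - (g j)⁻¹ - β j) * (g j * g (j + 1)) =
      g j - g (j + 1) - β j * g j * g (j + 1) := by
    field_simp
  rw [e2, e]
  ring

/-- **One-step bound**: `|ǧ_{j+1}⁻¹ - ǧ_j⁻¹ - β_j| ≤ 2B·β_jǧ_j + (5/2)ρ_j`.
[cite: BauerschmidtBrydgesSlade2015LogCorr, §8.3 (proof of the second lemma: ψ(t) = t⁻², Σ r_lǧ_l⁻²)] -/
theorem abs_inv_succ_sub_le (j : ℕ) :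
    |(g (j + 1))⁻¹ - (g j)⁻¹ - β j| ≤ 2 * B * (β j * g j) + 5 / 2 * ρ j := by
  have hgj := h.g_pos j
  have hgj1 := h.g_pos (j + 1)
  have hsucc := h.g_succ_ge j
  have hβ0 : 0 ≤ β j := h.beta_nonneg j
  obtain ⟨hb0, hb1⟩ := h.beta_mul_mem j
  have hr := h.rem_le j
  have hρ := h.rho_nonneg j
  have hB := h.B_nonneg
  rw [h.inv_succ_sub_inv_sub_beta j, abs_div, abs_of_pos (mul_pos hgj hgj1),
    div_le_iff₀ (mul_pos hgj hgj1)]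
  -- numerator: |βg(βg² - r) - r| ≤ βg(βg² + ρg²) + ρg²
  set r := flowRem β g j with hrdef
  have hc0 : 0 ≤ β j * g j ^ 2 := mul_nonneg hβ0 (sq_nonneg _)
  have hnum : |β j * g j * (β j * g j ^ 2 - r) - r| ≤
      β j * g j * (β j * g j ^ 2 + ρ j * g j ^ 2) + ρ j * g j ^ 2 :=
    calc |β j * g j * (β j * g j ^ 2 - r) - r|
        ≤ |β j * g j * (β j * g j ^ 2 - r)| + |r| := abs_sub _ _
      _ = β j * g j * |β j * g j ^ 2 - r| + |r| := by rw [abs_mul, abs_of_nonneg hb0]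
      _ ≤ β j * g j * (|β j * g j ^ 2| + |r|) + |r| :=
          add_le_add (mul_le_mul_of_nonneg_left (abs_sub _ _) hb0) le_rfl
      _ ≤ β j * g j * (β j * g j ^ 2 + ρ j * g j ^ 2) + ρ j * g j ^ 2 := by
          rw [abs_of_nonneg hc0]
          exact add_le_add (mul_le_mul_of_nonneg_left (add_le_add le_rfl hr) hb0) hr
  refine hnum.trans ?_
  -- compare with the right-hand side times `ǧ_jǧ_{j+1} ≥ ǧ_j²/2`
  have h1 : β j * g j * (β j * g j ^ 2) ≤ 2 * B * (β j * g j) * (g j * g (j + 1)) := by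
    have e1 : β j * g j * (β j * g j ^ 2) = (β j * g j) * β j * (g j * g j) := by ring
    have e2 : 2 * B * (β j * g j) * (g j * g (j + 1)) = (β j * g j) * B * (2 * (g j * g (j + 1))) := by
      ring
    rw [e1, e2]
    have h2 : (β j * g j) * β j * (g j * g j) ≤ (β j * g j) * B * (g j * g j) :=
      mul_le_mul_of_nonneg_right (mul_le_mul_of_nonneg_left (h.beta_le j) hb0)
        (mul_nonneg hgj.le hgj.le)
    refine h2.trans (mul_le_mul_of_nonneg_left ?_ (mul_nonneg hb0 hB))
    nlinarith
  have h2 : β j * g j * (ρ j * g j ^ 2) + ρ j * g j ^ 2 ≤ 5 / 2 * ρ j * (g j * g (j + 1)) := by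
    have hX : 0 ≤ ρ j * g j ^ 2 := mul_nonneg hρ (sq_nonneg _)
    have h3 : β j * g j * (ρ j * g j ^ 2) + ρ j * g j ^ 2 ≤ 5 / 4 * (ρ j * g j ^ 2) := by
      nlinarith
    refine h3.trans ?_
    have e3 : 5 / 2 * ρ j * (g j * g (j + 1)) = 5 / 4 * (ρ j * (2 * (g j * g (j + 1)))) := by ring
    rw [e3]
    refine mul_le_mul_of_nonneg_left (mul_le_mul_of_nonneg_left ?_ hρ) (by norm_num)
    nlinarith
  calc β j * g j * (β j * g j ^ 2 + ρ j * g j ^ 2) + ρ j * g j ^ 2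
      = β j * g j * (β j * g j ^ 2) + (β j * g j * (ρ j * g j ^ 2) + ρ j * g j ^ 2) := by ring
    _ ≤ 2 * B * (β j * g j) * (g j * g (j + 1)) + 5 / 2 * ρ j * (g j * g (j + 1)) :=
        add_le_add h1 h2
    _ = (2 * B * (β j * g j) + 5 / 2 * ρ j) * (g j * g (j + 1)) := by ring

/-- `β_jǧ_j ≤ log(ǧ_j/ǧ_{j+1}) + ρ_jǧ_j`: with `ǧ_{j+1} = ǧ_j(1 - ε_j)`, `ε_j = β_jǧ_j - r_j/ǧ_j`, one
has `ε_j ≤ -log(1 - ε_j)`. (For `r = 0`: `beta_mul_gbar_le_log` of `WeaklySAWCouplingFlow.lean`.)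
[cite: BauerschmidtBrydgesSlade2015Flow, Lemma 2.1 (proof of (ii)(b): ψ(t) = t⁻², the log term)] -/
theorem beta_mul_le_log_add (j : ℕ) :
    β j * g j ≤ Real.log (g j / g (j + 1)) + ρ j * g j := by
  have hgj := h.g_pos j
  have hgj1 := h.g_pos (j + 1)
  -- log (ǧ_{j+1}/ǧ_j) ≤ ǧ_{j+1}/ǧ_j - 1
  have hlog : Real.log (g (j + 1) / g j) ≤ g (j + 1) / g j - 1 :=
    Real.log_le_sub_one_of_pos (div_pos hgj1 hgj)
  have hrat : g (j + 1) / g j - 1 = -(β j * g j) + flowRem β g j / g j := by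
    rw [flowRem_spec β g j]
    field_simp
    ring
  have hinv : Real.log (g j / g (j + 1)) = -Real.log (g (j + 1) / g j) := by
    rw [← Real.log_inv, inv_div]
  have hrem : flowRem β g j / g j ≤ ρ j * g j := by
    rw [div_le_iff₀ hgj]
    calc flowRem β g j ≤ |flowRem β g j| := le_abs_self _
      _ ≤ ρ j * g j ^ 2 := h.rem_le j
      _ = ρ j * g j * g j := by ring
  rw [hinv]
  linarith

/-! ### The display with remainder: `ǧ_k⁻¹ = g₀⁻¹ + Σ_{j<k}β_j + O(log(g₀/ǧ_k)) + O(Σ_{j<k}ρ_j)` -/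

/-- `Σ_{j<k} log(ǧ_j/ǧ_{j+1}) = log(g₀/ǧ_k)`. [folklore] -/
theorem sum_log_ratio (k : ℕ) :
    ∑ j ∈ range k, Real.log (g j / g (j + 1)) = Real.log (g₀ / g k) := by
  induction k with
  | zero => simp [h.init, h.pos₀.ne']
  | succ k ih =>
    rw [Finset.sum_range_succ, ih, Real.log_div h.pos₀.ne' (h.g_pos k).ne',
      Real.log_div (h.g_pos k).ne' (h.g_pos (k + 1)).ne', Real.log_div h.pos₀.ne' (h.g_pos (k + 1)).ne']
    ring

/-- `Σ_{j<k} β_jǧ_j ≤ log(g₀/ǧ_k) + Σ_{j<k} ρ_jǧ_j`.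
[cite: BauerschmidtBrydgesSlade2015Flow, Lemma 2.1 (proof of (ii)(b): the O(log(ĝ₀/ĝ_{k+1})) term)] -/
theorem sum_beta_mul_le (k : ℕ) :
    ∑ j ∈ range k, β j * g j ≤ Real.log (g₀ / g k) + ∑ j ∈ range k, ρ j * g j := by
  rw [← h.sum_log_ratio k, ← Finset.sum_add_distrib]
  exact Finset.sum_le_sum fun j _ => h.beta_mul_le_log_add j

/-- The telescoped reciprocal: `ǧ_k⁻¹ - g₀⁻¹ - Σ_{j<k}β_j = Σ_{j<k}(ǧ_{j+1}⁻¹ - ǧ_j⁻¹ - β_j)`. [folklore] -/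
theorem inv_sub_inv_sub_sum_eq (k : ℕ) :
    (g k)⁻¹ - g₀⁻¹ - ∑ j ∈ range k, β j =
      ∑ j ∈ range k, ((g (j + 1))⁻¹ - (g j)⁻¹ - β j) := by
  induction k with
  | zero => simp [h.init]
  | succ k ih => rw [Finset.sum_range_succ, Finset.sum_range_succ, ← ih]; ring

/-- **The display of the proof of the second lemma of §8.3, with its remainder explicit**:
`|ǧ_k⁻¹ - g₀⁻¹ - Σ_{j<k}β_j| ≤ 2B log(g₀/ǧ_k) + 3Σ_{j<k}ρ_j` for every `k` — in print
"`ǧ_k⁻¹ = g₀⁻¹ + Σ_{j<k}β_j + O(log ǧ_k)`", the remainder contributing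
`Σ_{l<k} r_lǧ_l⁻² = O(Σ_{l<k}χ_lḡ_l)`, which is `3Σ_{j<k}ρ_j` here.
[cite: BauerschmidtBrydgesSlade2015LogCorr, §8.3 (proof of the second lemma, the display for ǧ_k⁻¹)]
[cite: BauerschmidtBrydgesSlade2015Flow, Lemma 2.1 (proof of (ii)(b))] -/
theorem abs_inv_sub_le (k : ℕ) :
    |(g k)⁻¹ - g₀⁻¹ - ∑ j ∈ range k, β j| ≤
      2 * B * Real.log (g₀ / g k) + 3 * ∑ j ∈ range k, ρ j := by
  rw [h.inv_sub_inv_sub_sum_eq k]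
  have hB := h.B_nonneg
  have hP : 0 ≤ ∑ j ∈ range k, ρ j := Finset.sum_nonneg fun j _ => h.rho_nonneg j
  -- 2B Σ ρ_jǧ_j ≤ 4Bg₀ Σρ_j ≤ (1/2) Σρ_j
  have hρg : ∑ j ∈ range k, ρ j * g j ≤ 2 * g₀ * ∑ j ∈ range k, ρ j := by
    rw [Finset.mul_sum]
    refine Finset.sum_le_sum fun j _ => ?_
    calc ρ j * g j ≤ ρ j * (2 * g₀) := mul_le_mul_of_nonneg_left (h.le_two_mul j) (h.rho_nonneg j)
      _ = 2 * g₀ * ρ j := by ring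
  have hρg' : 2 * B * ∑ j ∈ range k, ρ j * g j ≤ 1 / 2 * ∑ j ∈ range k, ρ j :=
    calc 2 * B * ∑ j ∈ range k, ρ j * g j ≤ 2 * B * (2 * g₀ * ∑ j ∈ range k, ρ j) :=
          mul_le_mul_of_nonneg_left hρg (by linarith)
      _ = 4 * (B * g₀) * ∑ j ∈ range k, ρ j := by ring
      _ ≤ 4 * (1 / 8) * ∑ j ∈ range k, ρ j :=
          mul_le_mul_of_nonneg_right (by linarith [h.small]) hP
      _ = 1 / 2 * ∑ j ∈ range k, ρ j := by ring
  calc |∑ j ∈ range k, ((g (j + 1))⁻¹ - (g j)⁻¹ - β j)|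
      ≤ ∑ j ∈ range k, |(g (j + 1))⁻¹ - (g j)⁻¹ - β j| := Finset.abs_sum_le_sum_abs _ _
    _ ≤ ∑ j ∈ range k, (2 * B * (β j * g j) + 5 / 2 * ρ j) :=
        Finset.sum_le_sum fun j _ => h.abs_inv_succ_sub_le j
    _ = 2 * B * ∑ j ∈ range k, β j * g j + 5 / 2 * ∑ j ∈ range k, ρ j := by
        rw [Finset.sum_add_distrib, Finset.mul_sum, Finset.mul_sum]
    _ ≤ 2 * B * (Real.log (g₀ / g k) + ∑ j ∈ range k, ρ j * g j) + 5 / 2 * ∑ j ∈ range k, ρ j :=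
        add_le_add (mul_le_mul_of_nonneg_left (h.sum_beta_mul_le k) (by linarith)) le_rfl
    _ = 2 * B * Real.log (g₀ / g k) + (2 * B * ∑ j ∈ range k, ρ j * g j
          + 5 / 2 * ∑ j ∈ range k, ρ j) := by ring
    _ ≤ 2 * B * Real.log (g₀ / g k) + 3 * ∑ j ∈ range k, ρ j := by
        refine add_le_add le_rfl ?_
        linarith

/-- The lower half: `g₀⁻¹ + Σ_{j<k}β_j - 2B log(g₀/ǧ_k) - 3Σ_{j<k}ρ_j ≤ ǧ_k⁻¹`.
[cite: BauerschmidtBrydgesSlade2015LogCorr, §8.3 (proof of the second lemma, the display for ǧ_k⁻¹)] -/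
theorem inv_ge (k : ℕ) :
    g₀⁻¹ + ∑ j ∈ range k, β j - (2 * B * Real.log (g₀ / g k) + 3 * ∑ j ∈ range k, ρ j) ≤
      (g k)⁻¹ := by
  have := (abs_le.1 (h.abs_inv_sub_le k)).1
  linarith

/-- The upper half: `ǧ_k⁻¹ ≤ g₀⁻¹ + Σ_{j<k}β_j + 2B log(g₀/ǧ_k) + 3Σ_{j<k}ρ_j`.
[cite: BauerschmidtBrydgesSlade2015LogCorr, §8.3 (proof of the second lemma, the display for ǧ_k⁻¹)] -/
theorem inv_le (k : ℕ) :
    (g k)⁻¹ ≤ g₀⁻¹ + ∑ j ∈ range k, β j + (2 * B * Real.log (g₀ / g k) + 3 * ∑ j ∈ range k, ρ j) := by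
  have := (abs_le.1 (h.abs_inv_sub_le k)).2
  linarith

/-! ### The limit `ǧ_∞` (summable remainder bound: the massive case) -/

/-- `|r_j|` is summable once `ρ` is (`|r_j| ≤ ρ_jǧ_j² ≤ ρ_j`).
[cite: BauerschmidtBrydgesSlade2015LogCorr, §8.3 (proof of the second lemma: dominated convergence)] -/
theorem summable_abs_rem (hρ : Summable ρ) : Summable fun j => |flowRem β g j| := by
  refine Summable.of_nonneg_of_le (fun j => abs_nonneg _) (fun j => ?_) hρ
  calc |flowRem β g j| ≤ ρ j * g j ^ 2 := h.rem_le j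
    _ ≤ ρ j * 1 := by
        refine mul_le_mul_of_nonneg_left ?_ (h.rho_nonneg j)
        nlinarith [h.g_le_one j, (h.g_pos j).le]
    _ = ρ j := mul_one _

/-- The auxiliary sequence `a_j = ǧ_j + Σ_{l≥j}|r_l|` is non-increasing
(`a_{j+1} - a_j = ǧ_{j+1} - ǧ_j - |r_j| = -β_jǧ_j² + r_j - |r_j| ≤ 0`). [folklore] -/
theorem aux_antitone (hρ : Summable ρ) :
    Antitone fun j => g j + ∑' l, |flowRem β g (l + j)| := by
  refine antitone_nat_of_succ_le fun j => ?_
  have hs := h.summable_abs_rem hρ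
  have hsj : Summable fun l => |flowRem β g (l + j)| := (summable_nat_add_iff j).2 hs
  have e : ∑' l, |flowRem β g (l + j)| = |flowRem β g j| + ∑' l, |flowRem β g (l + (j + 1))| := by
    rw [hsj.tsum_eq_zero_add]
    simp only [zero_add]
    congr 1
    exact tsum_congr fun l => by rw [show l + 1 + j = l + (j + 1) by ring]
  show g (j + 1) + ∑' l, |flowRem β g (l + (j + 1))| ≤ g j + ∑' l, |flowRem β g (l + j)|
  rw [e]
  linarith [h.g_succ_le j]

/-- `a_j = ǧ_j + Σ_{l≥j}|r_l| ≥ 0`. [folklore] -/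
theorem aux_nonneg (j : ℕ) : 0 ≤ g j + ∑' l, |flowRem β g (l + j)| :=
  add_nonneg (h.g_pos j).le (tsum_nonneg fun _ => abs_nonneg _)

/-- **Existence of `ǧ_∞ = lim_j ǧ_j`** when `Σ_jρ_j < ∞` (the case `m² > 0` of the source, where
the weights `χ_j` are summable): `ǧ_j = a_j - Σ_{l≥j}|r_l|` with `a_j` non-increasing and bounded
below and the tail sums tending to `0`. In print: "by the dominated convergence theorem … the limit
`ǧ_∞ = lim_{j→∞} ǧ_j = g₀ exp(Σ_k log(1 - β_kǧ_k + O(χ_kǧ_k²)))` exists".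
[cite: BauerschmidtBrydgesSlade2015LogCorr, §8.3 (second lemma: the limit ǧ_∞ exists)] -/
theorem exists_tendsto (hρ : Summable ρ) : ∃ L, Tendsto g atTop (𝓝 L) := by
  set a : ℕ → ℝ := fun j => g j + ∑' l, |flowRem β g (l + j)| with ha
  have hbdd : BddBelow (Set.range a) := ⟨0, by rintro _ ⟨j, rfl⟩; exact h.aux_nonneg j⟩
  have hA : Tendsto a atTop (𝓝 (⨅ j, a j)) := tendsto_atTop_ciInf (h.aux_antitone hρ) hbdd
  have hT : Tendsto (fun j => ∑' l, |flowRem β g (l + j)|) atTop (𝓝 0) :=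
    tendsto_sum_nat_add fun l => |flowRem β g l|
  refine ⟨(⨅ j, a j) - 0, ?_⟩
  refine (hA.sub hT).congr fun j => ?_
  simp [ha]

/-- `ǧ_j → ǧ_∞ := limUnder atTop ǧ`. [cite: BauerschmidtBrydgesSlade2015LogCorr, §8.3 (second lemma: ǧ_∞ = lim ǧ_j)] -/
theorem tendsto_limUnder (hρ : Summable ρ) : Tendsto g atTop (𝓝 (limUnder atTop g)) :=
  tendsto_nhds_limUnder (h.exists_tendsto hρ)

/-- A uniform lower bound: if also `Σ_jβ_j < ∞` then
`(3/4)ǧ_k⁻¹ ≤ g₀⁻¹ + Σ_jβ_j + 3Σ_jρ_j` for all `k` (from `inv_le` and `log(g₀/ǧ_k) ≤ g₀/ǧ_k - 1`).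
[cite: BauerschmidtBrydgesSlade2015LogCorr, §8.3 (proof of the second lemma)] -/
theorem inv_le_uniform (hβ : Summable β) (hρ : Summable ρ) (k : ℕ) :
    3 / 4 * (g k)⁻¹ ≤ g₀⁻¹ + ∑' j, β j + 3 * ∑' j, ρ j := by
  have h1 := h.inv_le k
  have hgk := h.g_pos k
  have hSk : ∑ j ∈ range k, β j ≤ ∑' j, β j :=
    hβ.sum_le_tsum (range k) (fun j _ => h.beta_nonneg j)
  have hPk : ∑ j ∈ range k, ρ j ≤ ∑' j, ρ j :=
    hρ.sum_le_tsum (range k) (fun j _ => h.rho_nonneg j)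
  have hlog : Real.log (g₀ / g k) ≤ g₀ / g k - 1 := Real.log_le_sub_one_of_pos (div_pos h.pos₀ hgk)
  have hB := h.B_nonneg
  have hinv : 0 < (g k)⁻¹ := inv_pos.2 hgk
  have h2 : 2 * B * Real.log (g₀ / g k) ≤ 2 * (B * g₀) * (g k)⁻¹ :=
    calc 2 * B * Real.log (g₀ / g k) ≤ 2 * B * (g₀ / g k - 1) :=
          mul_le_mul_of_nonneg_left hlog (by linarith)
      _ ≤ 2 * B * (g₀ / g k) := by nlinarith
      _ = 2 * (B * g₀) * (g k)⁻¹ := by rw [div_eq_mul_inv]; ring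
  have h3 : 2 * (B * g₀) * (g k)⁻¹ ≤ 1 / 4 * (g k)⁻¹ :=
    mul_le_mul_of_nonneg_right (by linarith [h.small]) hinv.le
  linarith

/-- **`ǧ_∞ > 0`** in the massive case (`Σ_jβ_j < ∞`, `Σ_jρ_j < ∞`), with the explicit bound
`ǧ_∞ ≥ (3/4)/(g₀⁻¹ + Σ_jβ_j + 3Σ_jρ_j)`. [cite: BauerschmidtBrydgesSlade2015LogCorr, §8.3 (second lemma)] -/
theorem le_limUnder (hβ : Summable β) (hρ : Summable ρ) :
    3 / 4 / (g₀⁻¹ + ∑' j, β j + 3 * ∑' j, ρ j) ≤ limUnder atTop g := by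
  have hM : 0 < g₀⁻¹ + ∑' j, β j + 3 * ∑' j, ρ j := by
    have h1 : 0 < g₀⁻¹ := inv_pos.2 h.pos₀
    have h2 : 0 ≤ ∑' j, β j := tsum_nonneg h.beta_nonneg
    have h3 : 0 ≤ ∑' j, ρ j := tsum_nonneg h.rho_nonneg
    linarith
  refine ge_of_tendsto' (h.tendsto_limUnder hρ) fun k => ?_
  rw [div_le_iff₀ hM]
  have h1 := h.inv_le_uniform hβ hρ k
  have hgk := h.g_pos k
  calc (3 : ℝ) / 4 = 3 / 4 * (g k)⁻¹ * g k := by field_simp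
    _ ≤ (g₀⁻¹ + ∑' j, β j + 3 * ∑' j, ρ j) * g k := mul_le_mul_of_nonneg_right h1 hgk.le
    _ = g k * (g₀⁻¹ + ∑' j, β j + 3 * ∑' j, ρ j) := mul_comm _ _

/-- `ǧ_∞ > 0` (massive case). [cite: BauerschmidtBrydgesSlade2015LogCorr, §8.3 (second lemma)] -/
theorem limUnder_pos (hβ : Summable β) (hρ : Summable ρ) : 0 < limUnder atTop g := by
  refine lt_of_lt_of_le (div_pos (by norm_num) ?_) (h.le_limUnder hβ hρ)
  have h1 : 0 < g₀⁻¹ := inv_pos.2 h.pos₀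
  have h2 : 0 ≤ ∑' j, β j := tsum_nonneg h.beta_nonneg
  have h3 : 0 ≤ ∑' j, ρ j := tsum_nonneg h.rho_nonneg
  linarith

/-- `ǧ_∞ ≤ 2g₀`. [folklore] -/
theorem limUnder_le (hρ : Summable ρ) : limUnder atTop g ≤ 2 * g₀ :=
  le_of_tendsto' (h.tendsto_limUnder hρ) h.le_two_mul

/-- **"`ǧ_∞⁻¹ + O(|log ǧ_∞|) = g₀⁻¹ + 𝖡_{m²}`" with explicit constants**: in the massive case,
`|ǧ_∞⁻¹ - g₀⁻¹ - Σ_jβ_j| ≤ 2B log(g₀/ǧ_∞) + 3Σ_jρ_j` (in the source `Σ_jβ_j = 𝖡_{m²}` by the first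
lemma of §8.3 and `3Σ_jρ_j = O(Σ_jχ_jḡ_j) = O(|log ǧ_∞|)`).
[cite: BauerschmidtBrydgesSlade2015LogCorr, §8.3 (proof of the second lemma: ǧ_∞⁻¹ + O(|log ǧ_∞|) = g₀⁻¹ + 𝖡_{m²})] -/
theorem abs_inv_limUnder_sub_le (hβ : Summable β) (hρ : Summable ρ) :
    |(limUnder atTop g)⁻¹ - g₀⁻¹ - ∑' j, β j| ≤
      2 * B * Real.log (g₀ / limUnder atTop g) + 3 * ∑' j, ρ j := by
  have hL := h.limUnder_pos hβ hρ
  have hT := h.tendsto_limUnder hρ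
  have hc : Tendsto (fun _ : ℕ => g₀) atTop (𝓝 g₀) := tendsto_const_nhds
  have hc' : Tendsto (fun _ : ℕ => g₀⁻¹) atTop (𝓝 g₀⁻¹) := tendsto_const_nhds
  -- left-hand side as a limit
  have hlhs : Tendsto (fun k => |(g k)⁻¹ - g₀⁻¹ - ∑ j ∈ range k, β j|) atTop
      (𝓝 |(limUnder atTop g)⁻¹ - g₀⁻¹ - ∑' j, β j|) :=
    (((hT.inv₀ hL.ne').sub hc').sub hβ.tendsto_sum_tsum_nat).abs
  -- right-hand side as a limit
  have hrhs : Tendsto (fun k => 2 * B * Real.log (g₀ / g k) + 3 * ∑ j ∈ range k, ρ j) atTop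
      (𝓝 (2 * B * Real.log (g₀ / limUnder atTop g) + 3 * ∑' j, ρ j)) :=
    (((hc.div hT hL.ne').log (div_pos h.pos₀ hL).ne').const_mul _).add
      (hρ.tendsto_sum_tsum_nat.const_mul _)
  exact le_of_tendsto_of_tendsto' hlhs hrhs h.abs_inv_sub_le

end GchHyp

/-! ### The asymptotic step: `x⁻¹ = g₀⁻¹ + S + O(|log x|)`, `S → ∞` ⟹ `xS → 1` -/

/-- If `x_i > 0`, `|x_i⁻¹ - g₀(i)⁻¹ - S_i| ≤ E_i` eventually, `S_i → ∞`, `g₀(i) → ĝ₀ > 0` and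
`E_i/S_i → 0`, then `x_iS_i → 1`. [folklore] -/
theorem tendsto_mul_of_abs_inv_sub_le {ι : Type*} {l : Filter ι} {x g0 S E : ι → ℝ} {ĝ₀ : ℝ}
    (hx : ∀ i, 0 < x i) (hE : ∀ᶠ i in l, |(x i)⁻¹ - (g0 i)⁻¹ - S i| ≤ E i)
    (hS : Tendsto S l atTop) (hg0 : Tendsto g0 l (𝓝 ĝ₀)) (hĝ₀ : 0 < ĝ₀)
    (hES : Tendsto (fun i => E i / S i) l (𝓝 0)) :
    Tendsto (fun i => x i * S i) l (𝓝 1) := by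
  -- (x S)⁻¹ = x⁻¹/S = 1 + g₀⁻¹/S + (x⁻¹ - g₀⁻¹ - S)/S
  have hg0S : Tendsto (fun i => (g0 i)⁻¹ / S i) l (𝓝 0) := (hg0.inv₀ hĝ₀.ne').div_atTop hS
  have hone : Tendsto (fun _ : ι => (1 : ℝ)) l (𝓝 1) := tendsto_const_nhds
  have hup : Tendsto (fun i => 1 + (g0 i)⁻¹ / S i + E i / S i) l (𝓝 1) := by
    have := (hone.add hg0S).add hES
    simpa only [add_zero] using this
  have hlow : Tendsto (fun i => 1 + (g0 i)⁻¹ / S i - E i / S i) l (𝓝 1) := by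
    have := (hone.add hg0S).sub hES
    simpa only [add_zero, sub_zero] using this
  have e : ∀ i, 0 < S i →
      (x i * S i)⁻¹ = 1 + (g0 i)⁻¹ / S i + ((x i)⁻¹ - (g0 i)⁻¹ - S i) / S i := by
    intro i hSi
    have hx0 := (hx i).ne'
    have hS0 := hSi.ne'
    rw [mul_inv, add_assoc, ← add_div]
    field_simp
    ring
  have hinv : Tendsto (fun i => (x i * S i)⁻¹) l (𝓝 1) := by
    refine tendsto_of_tendsto_of_tendsto_of_le_of_le' hlow hup ?_ ?_
    · filter_upwards [hE, hS.eventually_gt_atTop 0] with i hi hSi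
      have hD : -E i ≤ (x i)⁻¹ - (g0 i)⁻¹ - S i := by
        linarith [neg_abs_le ((x i)⁻¹ - (g0 i)⁻¹ - S i)]
      have h1 := div_le_div_of_nonneg_right hD hSi.le
      rw [neg_div] at h1
      rw [e i hSi]
      linarith
    · filter_upwards [hE, hS.eventually_gt_atTop 0] with i hi hSi
      have hD : (x i)⁻¹ - (g0 i)⁻¹ - S i ≤ E i := (le_abs_self _).trans hi
      have h1 := div_le_div_of_nonneg_right hD hSi.le
      rw [e i hSi]
      linarith
  simpa using hinv.inv₀ one_ne_zero

/-- `log(3u)/u → 0` as `u → ∞`. [folklore] -/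
theorem tendsto_log_three_mul_div_atTop :
    Tendsto (fun u : ℝ => Real.log (3 * u) / u) atTop (𝓝 0) := by
  have h1 : Tendsto (fun u : ℝ => 3 * u) atTop atTop :=
    Tendsto.const_mul_atTop (by norm_num) tendsto_id
  have h2 := (Real.tendsto_pow_log_div_mul_add_atTop (1 / 3) 0 1 (by norm_num)).comp h1
  refine h2.congr' ?_
  filter_upwards [eventually_gt_atTop 0] with u hu
  simp only [Function.comp_apply, pow_one]
  congr 1
  ring

/-- **The asymptotic step of the second lemma of §8.3, in the abstract**: if `0 < x_i ≤ 1`,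
`|x_i⁻¹ - g₀(i)⁻¹ - S_i| ≤ A + A'|log x_i|` eventually (`A' ≥ 0`), `S_i → ∞` and
`g₀(i) → ĝ₀ > 0`, then `x_iS_i → 1` — "`ǧ_∞⁻¹ + O(|log ǧ_∞|) = g₀⁻¹ + 𝖡_{m²}`, in particular
`ǧ_∞ → 0` …, finally `ǧ_∞ ∼ 1/𝖡_{m²}` follows". (From the hypothesis, `u = x⁻¹` satisfies
`u ≤ O(S) + 2A'√u`, so `u = O(S)` and `|log x| = log u = O(log S) = o(S)`.)
[cite: BauerschmidtBrydgesSlade2015LogCorr, §8.3 (proof of the second lemma, last two sentences)] -/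
theorem tendsto_mul_of_abs_inv_sub_le_log {ι : Type*} {l : Filter ι} {x g0 S : ι → ℝ}
    {ĝ₀ A A' : ℝ} (hx : ∀ i, 0 < x i) (hx1 : ∀ i, x i ≤ 1) (hA' : 0 ≤ A')
    (hE : ∀ᶠ i in l, |(x i)⁻¹ - (g0 i)⁻¹ - S i| ≤ A + A' * |Real.log (x i)|)
    (hS : Tendsto S l atTop) (hg0 : Tendsto g0 l (𝓝 ĝ₀)) (hĝ₀ : 0 < ĝ₀) :
    Tendsto (fun i => x i * S i) l (𝓝 1) := by
  refine tendsto_mul_of_abs_inv_sub_le hx hE hS hg0 hĝ₀ ?_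
  show Tendsto (fun i => (A + A' * |Real.log (x i)|) / S i) l (𝓝 0)
  -- Step 1: u = x⁻¹ ≥ 1 and |log x| = log u ≥ 0
  have hu1 : ∀ i, 1 ≤ (x i)⁻¹ := fun i => one_le_inv_iff₀.2 ⟨hx i, hx1 i⟩
  have hlogu : ∀ i, |Real.log (x i)| = Real.log (x i)⁻¹ := fun i => by
    rw [Real.log_inv, abs_of_nonpos (Real.log_nonpos (hx i).le (hx1 i))]
  -- g₀(i) ≥ ĝ₀/2 eventually
  have hg0low : ∀ᶠ i in l, ĝ₀ / 2 < g0 i := hg0.eventually (eventually_gt_nhds (by linarith))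
  -- Step 2: eventually u ≤ 3S
  set K : ℝ := 2 / ĝ₀ + |A| + 2 * A' ^ 2 with hK
  have hu_le : ∀ᶠ i in l, (x i)⁻¹ ≤ 3 * S i := by
    filter_upwards [hE, hg0low, hS.eventually_ge_atTop (2 * K)] with i hi hgi hSi
    have hu0 : 0 < (x i)⁻¹ := inv_pos.2 (hx i)
    -- log u ≤ 2√u
    have hlog2 : Real.log (x i)⁻¹ ≤ 2 * Real.sqrt (x i)⁻¹ := by
      have h1 : Real.log (Real.sqrt (x i)⁻¹) ≤ Real.sqrt (x i)⁻¹ - 1 :=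
        Real.log_le_sub_one_of_pos (Real.sqrt_pos.2 hu0)
      have h2 : Real.log (Real.sqrt (x i)⁻¹) = Real.log (x i)⁻¹ / 2 := by
        rw [Real.sqrt_eq_rpow, Real.log_rpow hu0]; ring
      rw [h2] at h1
      linarith [Real.sqrt_nonneg (x i)⁻¹]
    have hg0inv : (g0 i)⁻¹ ≤ 2 / ĝ₀ :=
      calc (g0 i)⁻¹ ≤ (ĝ₀ / 2)⁻¹ := inv_anti₀ (by positivity) hgi.le
        _ = 2 / ĝ₀ := by rw [inv_div]
    have h3 : (x i)⁻¹ ≤ (g0 i)⁻¹ + S i + A + A' * Real.log (x i)⁻¹ := by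
      have := (abs_le.1 hi).2
      rw [hlogu i] at this
      linarith
    -- A' log u ≤ 2A'√u ≤ 2A'² + u/2
    have h4 : A' * Real.log (x i)⁻¹ ≤ 2 * A' ^ 2 + (x i)⁻¹ / 2 := by
      have h5 : A' * Real.log (x i)⁻¹ ≤ A' * (2 * Real.sqrt (x i)⁻¹) :=
        mul_le_mul_of_nonneg_left hlog2 hA'
      have h6 : A' * (2 * Real.sqrt (x i)⁻¹) ≤ 2 * A' ^ 2 + (x i)⁻¹ / 2 := by
        nlinarith [sq_nonneg (2 * A' - Real.sqrt (x i)⁻¹), Real.sq_sqrt hu0.le,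
          Real.sqrt_nonneg (x i)⁻¹]
      linarith
    have h8 : (g0 i)⁻¹ + A + 2 * A' ^ 2 ≤ K := by rw [hK]; linarith [le_abs_self A]
    linarith
  -- Step 3: squeeze E/S between -|A|/S and (|A| + A' log(3S))/S
  have hlower : Tendsto (fun i => -|A| / S i) l (𝓝 0) := tendsto_const_nhds.div_atTop hS
  have hupper : Tendsto (fun i => (|A| + A' * Real.log (3 * S i)) / S i) l (𝓝 0) := by
    have h1 : Tendsto (fun i => |A| / S i) l (𝓝 0) := tendsto_const_nhds.div_atTop hS
    have h2 : Tendsto (fun i => A' * (Real.log (3 * S i) / S i)) l (𝓝 (A' * 0)) :=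
      (tendsto_log_three_mul_div_atTop.comp hS).const_mul A'
    rw [mul_zero] at h2
    have h12 := h1.add h2
    rw [add_zero] at h12
    refine h12.congr' (Eventually.of_forall fun i => ?_)
    show |A| / S i + A' * (Real.log (3 * S i) / S i) = (|A| + A' * Real.log (3 * S i)) / S i
    rw [add_div, mul_div_assoc]
  refine tendsto_of_tendsto_of_tendsto_of_le_of_le' hlower hupper ?_ ?_
  · filter_upwards [hS.eventually_gt_atTop 0] with i hSi
    refine div_le_div_of_nonneg_right ?_ hSi.le
    have := mul_nonneg hA' (abs_nonneg (Real.log (x i)))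
    linarith [neg_abs_le A]
  · filter_upwards [hS.eventually_gt_atTop 0, hu_le] with i hSi hui
    refine div_le_div_of_nonneg_right (add_le_add (le_abs_self A) ?_) hSi.le
    refine mul_le_mul_of_nonneg_left ?_ hA'
    rw [hlogu i]
    exact Real.log_le_log (inv_pos.2 (hx i)) hui

/-! ### `ǧ_∞ ∼ 1/Σ_jβ_j` for families of perturbed flows -/

/-- **`ǧ_∞ · Σ_jβ_j → 1`** along any family of perturbed flows (`GchHyp (β i) (ρ i) (g i) B (g₀ i)`,
massive case: `β i`, `ρ i` summable) on which `Σ_jβ_j(i) → ∞`, `g₀(i) → ĝ₀ > 0`, and (eventually)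
the summed remainder bound is `O(|log ǧ_∞|)`: `Σ_jρ_j(i) ≤ A + A'|log ǧ_∞(i)|` (in the source
`Σ_lχ_lḡ_l = O(|log ǧ_∞|)` by [BBS-rg-flow, Lemma 2.1(ii)(a)]). With `Σ_jβ_j = 𝖡_{m²}` (first
lemma of §8.3) and `𝖡_{m²} → ∞` as `m² ↓ 0` ((1.8)), this is "`ǧ_∞ ∼ 1/𝖡_{m²}` as `m² ↓ 0` and
`g₀ → ĝ₀`" of the second lemma of §8.3, now including the remainder `r_j`; for `r = 0` it is
`tendsto_gbarLim_mul_tsum` of `WeaklySAWCouplingFlow.lean`.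
[cite: BauerschmidtBrydgesSlade2015LogCorr, §8.3 (second lemma: ǧ_∞ ∼ 1/𝖡_{m²})] -/
theorem tendsto_limUnder_mul_tsum {ι : Type*} {l : Filter ι} {βf ρf gf : ι → ℕ → ℝ} {B : ℝ}
    {g0 : ι → ℝ} {ĝ₀ A A' : ℝ} (hh : ∀ i, GchHyp (βf i) (ρf i) (gf i) B (g0 i))
    (hβ : ∀ i, Summable (βf i)) (hρ : ∀ i, Summable (ρf i)) (hA' : 0 ≤ A')
    (hP : ∀ᶠ i in l, ∑' j, ρf i j ≤ A + A' * |Real.log (limUnder atTop (gf i))|)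
    (hS : Tendsto (fun i => ∑' j, βf i j) l atTop) (hg : Tendsto g0 l (𝓝 ĝ₀)) (hĝ₀ : 0 < ĝ₀) :
    Tendsto (fun i => limUnder atTop (gf i) * ∑' j, βf i j) l (𝓝 1) := by
  rcases isEmpty_or_nonempty ι with hι | hι
  · rw [l.filter_eq_bot_of_isEmpty]; exact tendsto_bot
  obtain ⟨i₀⟩ := hι
  have hB : 0 ≤ B := (hh i₀).B_nonneg
  -- positivity and `≤ 1` of the limits
  have hL : ∀ i, 0 < limUnder atTop (gf i) := fun i => (hh i).limUnder_pos (hβ i) (hρ i)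
  have hL1 : ∀ i, limUnder atTop (gf i) ≤ 1 := fun i =>
    ((hh i).limUnder_le (hρ i)).trans (by linarith [(hh i).g₀_le])
  -- |log g₀(i)| is eventually bounded by a constant M
  set M : ℝ := |Real.log ĝ₀| + 1 with hMdef
  have hM : ∀ᶠ i in l, |Real.log (g0 i)| < M := by
    have hc : Tendsto (fun i => |Real.log (g0 i)|) l (𝓝 |Real.log ĝ₀|) :=
      ((Real.continuousAt_log hĝ₀.ne').tendsto.comp hg).abs
    exact hc.eventually (eventually_lt_nhds (by rw [hMdef]; linarith))
  refine tendsto_mul_of_abs_inv_sub_le_log (A := 2 * B * M + 3 * A) (A' := 2 * B + 3 * A')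
    hL hL1 (by positivity) ?_ hS hg hĝ₀
  filter_upwards [hM, hP] with i hMi hPi
  have key := (hh i).abs_inv_limUnder_sub_le (hβ i) (hρ i)
  have hLi := hL i
  have hlog : Real.log (g0 i / limUnder atTop (gf i)) ≤ M + |Real.log (limUnder atTop (gf i))| := by
    rw [Real.log_div (hh i).pos₀.ne' hLi.ne']
    linarith [le_abs_self (Real.log (g0 i)), neg_abs_le (Real.log (limUnder atTop (gf i)))]
  calc |(limUnder atTop (gf i))⁻¹ - (g0 i)⁻¹ - ∑' j, βf i j|
      ≤ 2 * B * Real.log (g0 i / limUnder atTop (gf i)) + 3 * ∑' j, ρf i j := key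
    _ ≤ 2 * B * (M + |Real.log (limUnder atTop (gf i))|)
          + 3 * (A + A' * |Real.log (limUnder atTop (gf i))|) :=
        add_le_add (mul_le_mul_of_nonneg_left hlog (by positivity))
          (mul_le_mul_of_nonneg_left hPi (by norm_num))
    _ = 2 * B * M + 3 * A + (2 * B + 3 * A') * |Real.log (limUnder atTop (gf i))| := by ring

end CTWSAW

end Literature.Barriers.CriticalPhenomena
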